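import Literature.MathematicalPhysics.QuantumFieldTheory.Balaban1983to89.T3BareTailProfile
import Literature.MathematicalPhysics.QuantumFieldTheory.Balaban1983to89.T3HistoryTailReduction
import HarnessLib

/-!
# Route `SmallFieldWidening`, crux r3 `LargeFieldMassRefinementTail` (stmt-QuantumFields-22884), line `birth`:
# stub `stub_massOfPerPlaquette` — the per-run large-field mass from a per-plaquette tail (the bookkeeping, PROVED)

Lead prover `ym-line-sfw-p2` (2026-08-27).  The registered stub `stub_massOfPerPlaquette` of the line's skeleton
(`Summits/QuantumFields/YangMills/Cruxes/LargeFieldMassRefinementTail/Lines/birth.lean`, v2).  HYPOTHESIS (the line's physics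
stub `stub_perPlaquetteTail`, spelled out — nothing is asserted here): for the block size `L`, a profile `(b₀, p₀)`, a threshold
`γ₁ ≤ 1` and constants `C, A, c`, every family `F` with `F.L = L`, every `0 < γ ≤ γ₁`, every run `K`, every height `1 ≤ j ≤ K` and
every plaquette `p` of `T^{(j)}` satisfy `Gibbs_K{θ(K−j) ≤ |Ū^{j}(∂p) − 1|} ≤ C·β_{K−j}^A·exp(−c·p(g_{K−j})²)` (the per-plaquette
large-field factor of [Balaban1985UV3] (71) p.273 as a Gibbs-probability statement; `β_i = (γL^{-i})⁻¹`, `g_i = √(γL^{-i})`,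
`θ = θBal`, `p = B10.pFun b₀ p₀`).  CONCLUSION: with `C' = 72(C + 2e^{24}c₃⁻³)`, `c' = min c ¼`, `A' = max A 5` (`c₃ = c₃(2) > 0` the
Haar small-ball constant of the tree's chessboard estimate), for the same families and couplings and EVERY run `K`,

  `Gibbs_K((histGood F ℰp θ K 0)ᶜ) ≤ Σ_{i ≤ K} C'·L^{3(m+i)}·β_i^{A'}·exp(−c'·p(g_i)²)`.

Proof: the union bound over the constrained heights `j ≤ K` (tree `T3HistoryTailReduction.real_compl_histGood_le_sum`), then per
height: `j = 0` is the landed finest-height chessboard tail `T3FinestHeightTail.gibbsK_real_not_plaqSmall_le`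
(`#Plaq·2e^{24}c₃⁻³·(√β_K)⁹·e^{−p²/4}`, `(√β)⁹ ≤ β⁵` for `β ≥ 1`); `j ≥ 1` is the union bound over the `≤ 72·L^{3(m+K−j)}` plaquettes
of height `j` (tree `T3CruxEstimates.real_not_plaqSmall_comp_le_sum`) and the hypothesis; finally the reindexing `i = K − j`.
The technique is VERBATIM that of the tree's K2 bookkeeping (`T3BareTailProfile.bareTailAt`,
`T3AveragedTailProfile.averagedTailAt_of_perPlaquette`), kept in finite-sum form (no profile) because the refinement tail of r3 is
taken along `n`, not along `K`.  No summit statement is touched (the YM mass gap is not proved by this line).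
-/

noncomputable section

open MeasureTheory Filter Topology
open Literature.MathematicalPhysics.QuantumFieldTheory
open Literature.MathematicalPhysics.QuantumFieldTheory.Balaban1983to89
open Literature.MathematicalPhysics.QuantumFieldTheory.Balaban1983to89.Missing
open Literature.MathematicalPhysics.QuantumFieldTheory.Balaban1983to89.T3ContinuumYM3Torus
open Literature.MathematicalPhysics.QuantumFieldTheory.Balaban1983to89.T3UnitScaleTilt
open Literature.MathematicalPhysics.QuantumFieldTheory.Balaban1983to89.T3UnitLawDensityEML
open Literature.MathematicalPhysics.QuantumFieldTheory.Balaban1983to89.T3CruxEstimates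
open Literature.MathematicalPhysics.QuantumFieldTheory.Balaban1983to89.T3FinestHeightTail
open Literature.MathematicalPhysics.QuantumFieldTheory.Balaban1983to89.T3HistoryTailReduction

namespace Summit.QuantumFields.YangMills.Theorems.LargeFieldMassRefinementTail

/-- `(√y)⁹ ≤ y⁵` for `y ≥ 1`. [folklore] -/
theorem sqrt_pow_nine_le_pow_five {y : ℝ} (hy : 1 ≤ y) : Real.sqrt y ^ 9 ≤ y ^ 5 := by
  have hy0 : 0 ≤ y := zero_le_one.trans hy
  have hs : Real.sqrt y ^ 2 = y := Real.sq_sqrt hy0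
  have hsy : Real.sqrt y ≤ y := by
    rw [Real.sqrt_le_left hy0]
    nlinarith
  calc Real.sqrt y ^ 9 = (Real.sqrt y ^ 2) ^ 4 * Real.sqrt y := by ring
    _ = y ^ 4 * Real.sqrt y := by rw [hs]
    _ ≤ y ^ 4 * y := by gcongr
    _ = y ^ 5 := by ring

/-- **`#plaquettes of T^{(j)} ≤ 72·L^{3(m + (K − j))}`** for `j ≤ K` (`2L^{m+K−j}` sites per direction, `≤ 9` plane labels per
site). [cite: Balaban1985UV3, (1)-(3) p.256] -/
theorem card_plaq_le (F : T3Family) {K j : ℕ} (hj : j ≤ K) :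
    (Fintype.card (Plaq (F.P K) j) : ℝ) ≤ 72 * (F.L : ℝ) ^ (3 * (F.m + (K - j))) := by
  have hsites : (F.P K).sitesPerDir j = 2 * F.L ^ (F.m + (K - j)) := by
    show 2 * F.L ^ (F.m + K - j) = 2 * F.L ^ (F.m + (K - j))
    rw [show F.m + K - j = F.m + (K - j) by omega]
  have h1 : Fintype.card (Plaq (F.P K) j) = Fintype.card (Plaquette 3 ((F.P K).sitesPerDir j)) :=
    Fintype.card_congr (plaqEquiv (P := F.P K) j)
  have h2 : Fintype.card (Plaquette 3 ((F.P K).sitesPerDir j)) ≤ ((F.P K).sitesPerDir j) ^ 3 * 3 ^ 2 := by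
    rw [Fintype.card_prod, Fintype.card_fun, ZMod.card, Fintype.card_fin]
    gcongr
    calc Fintype.card {p : Fin 3 × Fin 3 // p.1 < p.2} ≤ Fintype.card (Fin 3 × Fin 3) := Fintype.card_subtype_le _
      _ = 3 ^ 2 := by rw [Fintype.card_prod, Fintype.card_fin]; norm_num
  rw [h1]
  calc (Fintype.card (Plaquette 3 ((F.P K).sitesPerDir j)) : ℝ) ≤ (((F.P K).sitesPerDir j) ^ 3 * 3 ^ 2 : ℕ) := by
        exact_mod_cast h2
    _ = 72 * (F.L : ℝ) ^ (3 * (F.m + (K - j))) := by rw [hsites]; push_cast; ring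

/-- **Stub `stub_massOfPerPlaquette` of line `birth`** (crux r3 `LargeFieldMassRefinementTail`, stmt-QuantumFields-22884): a
UNIFORM per-plaquette large-field tail for the block-averaged heights `1 ≤ j ≤ K` implies the uniform per-run bound of the Gibbs
mass of the complement of the all-heights small-field event by the finite sum `Σ_{i ≤ K} C'·L^{3(m+i)}·β_i^{A'}·exp(−c'·p(g_i)²)`
(union bound over heights and plaquettes; the bare height is the chessboard estimate). [cite: Balaban1985UV3, (7) p.257 and (71) p.273] -/
theorem stub_massOfPerPlaquette :
    ∀ (L : ℕ) (b₀ p₀ γ₁ C c : ℝ) (A : ℕ), 0 < b₀ → 1 ≤ p₀ → 0 < γ₁ → γ₁ ≤ 1 → 0 ≤ C → 0 < c →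
      (∀ (F : T3Family) (γ : ℝ), F.L = L → 0 < γ → γ ≤ γ₁ →
        ∀ (K j : ℕ), 1 ≤ j → j ≤ K → ∀ p : Plaq (F.P K) j,
          (gibbsK F ℰp γ K).real
              {U | θBal F.L γ b₀ p₀ (K - j) ≤
                GaugeGroup.dist1 (GaugeField.plaqHol
                  (Averaging.iter (fun i => BlockAveraging.blockAvg (P := F.P K) (j := i) ℰp) j U) p)} ≤
            C * (F.scheme ℰp γ).β (K - j) ^ A *
              Real.exp (-(c * B10.pFun b₀ p₀ (Real.sqrt (γ * ((F.L : ℝ)⁻¹) ^ (K - j))) ^ 2))) →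
      ∃ (C' c' : ℝ) (A' : ℕ), 0 ≤ C' ∧ 0 < c' ∧
        ∀ (F : T3Family) (γ : ℝ), F.L = L → 0 < γ → γ ≤ γ₁ → ∀ K : ℕ,
          (gibbsK F ℰp γ K).real (histGood F ℰp (θBal F.L γ b₀ p₀) K 0)ᶜ ≤
            ∑ i ∈ Finset.range (K + 1), C' * (F.L : ℝ) ^ (3 * (F.m + i)) * ((γ * ((F.L : ℝ)⁻¹) ^ i)⁻¹) ^ A' *
              Real.exp (-(c' * B10.pFun b₀ p₀ (Real.sqrt (γ * ((F.L : ℝ)⁻¹) ^ i)) ^ 2)) := by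
  intro L b₀ p₀ γ₁ C c A hb₀ _hp₀ _hγ₁ hγ₁1 hC hc hschema
  obtain ⟨c₃, hc₃, -, hbare⟩ := gibbsK_real_not_plaqSmall_le
  have hD0 : (0 : ℝ) ≤ 2 * Real.exp 24 * (c₃ ^ 3)⁻¹ := by positivity
  refine ⟨72 * (C + 2 * Real.exp 24 * (c₃ ^ 3)⁻¹), min c (1 / 4), max A 5, by positivity, lt_min hc (by norm_num), ?_⟩
  intro F γ hFL hγ hγle K
  haveI := isProbabilityMeasure_gibbsK F ℰp hγ.le K
  have hγ1 : γ ≤ 1 := hγle.trans hγ₁1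
  have hL1 : (1 : ℝ) < F.L := by exact_mod_cast F.hL.2
  have hL0 : (0 : ℝ) < F.L := one_pos.trans hL1
  -- the envelope `B i` at distance `i` from the unit scale
  obtain ⟨B, hB⟩ : ∃ B : ℕ → ℝ, B = fun i => 72 * (C + 2 * Real.exp 24 * (c₃ ^ 3)⁻¹) * (F.L : ℝ) ^ (3 * (F.m + i)) *
      ((γ * ((F.L : ℝ)⁻¹) ^ i)⁻¹) ^ max A 5 *
        Real.exp (-(min c (1 / 4) * B10.pFun b₀ p₀ (Real.sqrt (γ * ((F.L : ℝ)⁻¹) ^ i)) ^ 2)) := ⟨_, rfl⟩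
  -- per-distance facts: `0 < γL^{-i} ≤ 1`, `β_i ≥ 1`, `p(g_i) ≥ 0`
  have hx : ∀ i : ℕ, 0 < γ * ((F.L : ℝ)⁻¹) ^ i ∧ γ * ((F.L : ℝ)⁻¹) ^ i ≤ 1 := fun i => by
    have hq0 : 0 < ((F.L : ℝ)⁻¹) ^ i := pow_pos (inv_pos.mpr hL0) i
    have hq1 : ((F.L : ℝ)⁻¹) ^ i ≤ 1 := pow_le_one₀ (inv_nonneg.mpr hL0.le) (inv_le_one_of_one_le₀ hL1.le)
    exact ⟨mul_pos hγ hq0, by nlinarith⟩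
  have hβ1 : ∀ i : ℕ, 1 ≤ (γ * ((F.L : ℝ)⁻¹) ^ i)⁻¹ := fun i => one_le_inv_iff₀.mpr (hx i)
  have hβeq : ∀ i : ℕ, (F.scheme ℰp γ).β i = (γ * ((F.L : ℝ)⁻¹) ^ i)⁻¹ := fun i => rfl
  have hβ0 : ∀ i : ℕ, 0 ≤ (F.scheme ℰp γ).β i := fun i => F.scheme_β_nonneg ℰp hγ.le i
  have hp0 : ∀ i : ℕ, 0 ≤ B10.pFun b₀ p₀ (Real.sqrt (γ * ((F.L : ℝ)⁻¹) ^ i)) := fun i => by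
    have hg0 : 0 < Real.sqrt (γ * ((F.L : ℝ)⁻¹) ^ i) := Real.sqrt_pos.mpr (hx i).1
    have hg1 : Real.sqrt (γ * ((F.L : ℝ)⁻¹) ^ i) ≤ 1 := Real.sqrt_le_one.mpr (hx i).2
    have hlog : 0 ≤ Real.log (Real.sqrt (γ * ((F.L : ℝ)⁻¹) ^ i))⁻¹ := by
      rw [Real.log_inv]; exact neg_nonneg.mpr (Real.log_nonpos hg0.le hg1)
    exact mul_nonneg hb₀.le (Real.rpow_nonneg (by linarith) _)
  have hexp : ∀ (i : ℕ) {c₀ : ℝ}, min c (1 / 4) ≤ c₀ →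
      Real.exp (-(c₀ * B10.pFun b₀ p₀ (Real.sqrt (γ * ((F.L : ℝ)⁻¹) ^ i)) ^ 2)) ≤
        Real.exp (-(min c (1 / 4) * B10.pFun b₀ p₀ (Real.sqrt (γ * ((F.L : ℝ)⁻¹) ^ i)) ^ 2)) := fun i c₀ hc₀ => by
    apply Real.exp_le_exp.mpr
    have := mul_le_mul_of_nonneg_right hc₀ (sq_nonneg (B10.pFun b₀ p₀ (Real.sqrt (γ * ((F.L : ℝ)⁻¹) ^ i))))
    linarith
  have hpowA : ∀ (i : ℕ) {A₀ : ℕ}, A₀ ≤ max A 5 →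
      (γ * ((F.L : ℝ)⁻¹) ^ i)⁻¹ ^ A₀ ≤ (γ * ((F.L : ℝ)⁻¹) ^ i)⁻¹ ^ max A 5 :=
    fun i _ hA₀ => pow_le_pow_right₀ (hβ1 i) hA₀
  have hCD : C ≤ C + 2 * Real.exp 24 * (c₃ ^ 3)⁻¹ := le_add_of_nonneg_right hD0
  have hDC : 2 * Real.exp 24 * (c₃ ^ 3)⁻¹ ≤ C + 2 * Real.exp 24 * (c₃ ^ 3)⁻¹ := le_add_of_nonneg_left hC
  -- Step 1: the union bound over the constrained heights `j ≤ K`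
  have h1 := real_compl_histGood_le_sum F ℰp (θBal F.L γ b₀ p₀) K 0 (gibbsK F ℰp γ K)
  rw [Nat.sub_zero] at h1
  refine h1.trans ?_
  -- Step 2: each height `j` is bounded by the envelope at distance `K − j`
  have hterm : ∀ j ∈ Finset.range (K + 1),
      (gibbsK F ℰp γ K).real {U | ¬ PlaqSmall (θBal F.L γ b₀ p₀ (K - j))
        (Averaging.iter (fun i => BlockAveraging.blockAvg (P := F.P K) (j := i) ℰp) j U)} ≤ B (K - j) := by
    intro j hj
    have hjK : j ≤ K := Nat.lt_succ_iff.mp (Finset.mem_range.mp hj)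
    rw [hB]
    dsimp only
    rcases Nat.eq_zero_or_pos j with rfl | hjpos
    · -- the bare height: chessboard estimate
      rw [Nat.sub_zero]
      have hb := hbare F γ hγ b₀ p₀ K (by rw [hβeq]; exact hβ1 K) (hp0 K)
      have hcard := card_plaq_le F (Nat.zero_le K)
      rw [Nat.sub_zero] at hcard
      have hs9 : Real.sqrt ((F.scheme ℰp γ).β K) ^ 9 ≤ (γ * ((F.L : ℝ)⁻¹) ^ K)⁻¹ ^ max A 5 := by
        rw [hβeq]
        exact (sqrt_pow_nine_le_pow_five (hβ1 K)).trans (hpowA K (le_max_right A 5))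
      have he : Real.exp (-(B10.pFun b₀ p₀ (Real.sqrt (γ * ((F.L : ℝ)⁻¹) ^ K)) ^ 2 / 4)) ≤
          Real.exp (-(min c (1 / 4) * B10.pFun b₀ p₀ (Real.sqrt (γ * ((F.L : ℝ)⁻¹) ^ K)) ^ 2)) := by
        have : -(B10.pFun b₀ p₀ (Real.sqrt (γ * ((F.L : ℝ)⁻¹) ^ K)) ^ 2 / 4) =
            -((1 / 4) * B10.pFun b₀ p₀ (Real.sqrt (γ * ((F.L : ℝ)⁻¹) ^ K)) ^ 2) := by ring
        rw [this]
        exact hexp K (min_le_right _ _)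
      calc (gibbsK F ℰp γ K).real {U | ¬ PlaqSmall (θBal F.L γ b₀ p₀ K)
              (Averaging.iter (fun i => BlockAveraging.blockAvg (P := F.P K) (j := i) ℰp) 0 U)}
          = (gibbsK F ℰp γ K).real {U | ¬ PlaqSmall (θBal F.L γ b₀ p₀ K) U} := rfl
        _ ≤ Fintype.card (Plaq (F.P K) 0) *
              (2 * Real.exp 24 * (c₃ ^ 3)⁻¹ * Real.sqrt ((F.scheme ℰp γ).β K) ^ 9 *
                Real.exp (-(B10.pFun b₀ p₀ (Real.sqrt (γ * ((F.L : ℝ)⁻¹) ^ K)) ^ 2 / 4))) := hb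
        _ ≤ (72 * (F.L : ℝ) ^ (3 * (F.m + K))) *
              ((C + 2 * Real.exp 24 * (c₃ ^ 3)⁻¹) * (γ * ((F.L : ℝ)⁻¹) ^ K)⁻¹ ^ max A 5 *
                Real.exp (-(min c (1 / 4) * B10.pFun b₀ p₀ (Real.sqrt (γ * ((F.L : ℝ)⁻¹) ^ K)) ^ 2))) := by
            gcongr
        _ = 72 * (C + 2 * Real.exp 24 * (c₃ ^ 3)⁻¹) * (F.L : ℝ) ^ (3 * (F.m + K)) *
              (γ * ((F.L : ℝ)⁻¹) ^ K)⁻¹ ^ max A 5 *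
                Real.exp (-(min c (1 / 4) * B10.pFun b₀ p₀ (Real.sqrt (γ * ((F.L : ℝ)⁻¹) ^ K)) ^ 2)) := by ring
    · -- an averaged height `j ≥ 1`: union bound over plaquettes + the hypothesis
      have hcard := card_plaq_le F hjK
      have hsA : (F.scheme ℰp γ).β (K - j) ^ A ≤ (γ * ((F.L : ℝ)⁻¹) ^ (K - j))⁻¹ ^ max A 5 := by
        rw [hβeq]
        exact hpowA (K - j) (le_max_left A 5)
      have he := hexp (K - j) (min_le_left c (1 / 4))
      have hβ0' := hβ0 (K - j)
      calc (gibbsK F ℰp γ K).real {U | ¬ PlaqSmall (θBal F.L γ b₀ p₀ (K - j))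
              (Averaging.iter (fun i => BlockAveraging.blockAvg (P := F.P K) (j := i) ℰp) j U)}
          ≤ ∑ p : Plaq (F.P K) j, (gibbsK F ℰp γ K).real
              {U | θBal F.L γ b₀ p₀ (K - j) ≤ GaugeGroup.dist1 (GaugeField.plaqHol
                (Averaging.iter (fun i => BlockAveraging.blockAvg (P := F.P K) (j := i) ℰp) j U) p)} :=
            real_not_plaqSmall_comp_le_sum (gibbsK F ℰp γ K)
              (fun U => Averaging.iter (fun i => BlockAveraging.blockAvg (P := F.P K) (j := i) ℰp) j U)
              (θBal F.L γ b₀ p₀ (K - j))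
        _ ≤ ∑ _p : Plaq (F.P K) j, C * (F.scheme ℰp γ).β (K - j) ^ A *
              Real.exp (-(c * B10.pFun b₀ p₀ (Real.sqrt (γ * ((F.L : ℝ)⁻¹) ^ (K - j))) ^ 2)) :=
            Finset.sum_le_sum fun p _ => hschema F γ hFL hγ hγle K j hjpos hjK p
        _ = Fintype.card (Plaq (F.P K) j) * (C * (F.scheme ℰp γ).β (K - j) ^ A *
              Real.exp (-(c * B10.pFun b₀ p₀ (Real.sqrt (γ * ((F.L : ℝ)⁻¹) ^ (K - j))) ^ 2))) := by
            rw [Finset.sum_const, Finset.card_univ, nsmul_eq_mul]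
        _ ≤ (72 * (F.L : ℝ) ^ (3 * (F.m + (K - j)))) *
              ((C + 2 * Real.exp 24 * (c₃ ^ 3)⁻¹) * (γ * ((F.L : ℝ)⁻¹) ^ (K - j))⁻¹ ^ max A 5 *
                Real.exp (-(min c (1 / 4) * B10.pFun b₀ p₀ (Real.sqrt (γ * ((F.L : ℝ)⁻¹) ^ (K - j))) ^ 2))) := by
            gcongr
        _ = 72 * (C + 2 * Real.exp 24 * (c₃ ^ 3)⁻¹) * (F.L : ℝ) ^ (3 * (F.m + (K - j))) *
              (γ * ((F.L : ℝ)⁻¹) ^ (K - j))⁻¹ ^ max A 5 *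
                Real.exp (-(min c (1 / 4) * B10.pFun b₀ p₀ (Real.sqrt (γ * ((F.L : ℝ)⁻¹) ^ (K - j))) ^ 2)) := by
            ring
  -- Step 3: sum and reindex `i = K − j`
  have hrefl : ∑ j ∈ Finset.range (K + 1), B (K - j) = ∑ i ∈ Finset.range (K + 1), B i := by
    have h := Finset.sum_range_reflect B (K + 1)
    simpa only [Nat.add_sub_cancel] using h
  calc ∑ j ∈ Finset.range (K + 1), (gibbsK F ℰp γ K).real {U | ¬ PlaqSmall (θBal F.L γ b₀ p₀ (K - j))
          (Averaging.iter (fun i => BlockAveraging.blockAvg (P := F.P K) (j := i) ℰp) j U)}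
        ≤ ∑ j ∈ Finset.range (K + 1), B (K - j) := Finset.sum_le_sum hterm
    _ = ∑ i ∈ Finset.range (K + 1), B i := hrefl
    _ = _ := by rw [hB]

end Summit.QuantumFields.YangMills.Theorems.LargeFieldMassRefinementTail

end
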